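import Literature.AnabelianGeometry.SemiGraphs.TemperedPiCompactnessCriterion
import Literature.AnabelianGeometry.SemiGraphs.TemperedPiTrees
import HarnessLib

/-!
# Limits of level-wise eventually constant sequences of continuous homomorphisms into
# `π₁^temp(𝒢) = lim_n Gal(𝒢_{∞,n}/𝒢)` ([SemiAnbd] Prop 3.6 (i) p. 38, Thm 3.7 (iii) p. 41)

Mochizuki, *Semi-graphs of anabelioids*, Publ. RIMS **42** (2006) [MochizukiSemiAnbd2006], Prop. 3.6 (i)
p. 38 (`π₁^temp(𝒢) := lim_i Gal(𝒢_{∞,i}/𝒢)` with the prodiscrete topology) and the proof of Thm. 3.7 (iii)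
p. 41 with the author's Comments (2020) (6)(b) ("converge, in the profinite topology").
[cite: MochizukiSemiAnbd2006, Prop 3.6(i) p.38]

PROOF-ONLY file (abc-iut cell, F-wave seat abc-iut-f-175 gen 2; FRONTIER programme REFUTE-F1732 follow-up,
towards the kernel decision of the ∀-countable typed forms F-2770 / F-2771; no definitions, no named facts).
Generic infrastructure over abc-iut-L3-t9's Galois tower `D : GaloisLevelData 𝒢`, the homomorphism-level
companion of abc-iut-w4-d071's `exists_forall_eventually_projAut_eq` (limits of level-wise eventually
constant sequences of ELEMENTS):

* `exists_limitHom` — a sequence of continuous homomorphisms `ζ_k : E →ₜ* π₁^temp(𝒢)` from a topologically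
  cyclic group `E = closure⟨e₀⟩` whose values AT `e₀` are level-wise eventually constant has a LIMIT: a
  continuous homomorphism `ζ : E →ₜ* π₁^temp(𝒢)` with `ρ_n ∘ ζ = ρ_n ∘ ζ_k` for `k ≫ n` (two continuous
  homomorphisms into the discrete `Gal_n` agreeing at `e₀` agree on `closure⟨e₀⟩`; then the compatible family
  `(ρ_n ∘ ζ_{M n})_n` defines `ζ` through the limit);
* `range_eq_topologicalClosure_zpowers` — the range of a continuous homomorphism from a compact topologically
  cyclic group is the closed procyclic subgroup `closure⟨ζ e₀⟩`, and it is compact.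

At `𝒢_θ` (abc-iut-L3-d1's countermodel) the `ζ_k` are the edge homomorphisms `ψ_{k+1} ∘ up` of the apartment
and the limit `ζ` parametrises the escaping compact `C = closure⟨c⟩`, `c = ζ(e₀) = lim z_k`.
Nothing here bears on [IUTchIII] Cor. 3.12; typed ≠ proved.
-/

namespace Literature.AnabelianGeometry.SemiGraphs

open CategoryTheory Topology

universe u

/-! ### The range of a continuous homomorphism from a compact topologically cyclic group -/

/-- **The range of a continuous homomorphism `ζ` from a compact topologically cyclic group
`E = closure⟨e₀⟩` into a Hausdorff topological group is the closed procyclic subgroup `closure⟨ζ e₀⟩`**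
(the image of the closure lies in the closure of the image; the range is compact, hence closed).
[cite: MochizukiSemiAnbd2006, Rmk 3.1.1 p.33] -/
theorem ContinuousMonoidHom.range_eq_topologicalClosure_zpowers {E : Type*} [Group E] [TopologicalSpace E]
    [IsTopologicalGroup E] [CompactSpace E] {Γ : Type*} [Group Γ] [TopologicalSpace Γ]
    [IsTopologicalGroup Γ] [T2Space Γ] (ζ : E →ₜ* Γ) (e₀ : E)
    (hgen : (Subgroup.zpowers e₀).topologicalClosure = ⊤) :
    ζ.toMonoidHom.range = (Subgroup.zpowers (ζ e₀)).topologicalClosure := by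
  apply le_antisymm
  · rintro _ ⟨t, rfl⟩
    have ht : t ∈ (Subgroup.zpowers e₀).topologicalClosure := by rw [hgen]; exact Subgroup.mem_top t
    have h1 : ζ t ∈ closure (ζ '' (Subgroup.zpowers e₀ : Set E)) :=
      image_closure_subset_closure_image ζ.continuous ⟨t, ht, rfl⟩
    have h2 : ζ '' (Subgroup.zpowers e₀ : Set E) = (Subgroup.zpowers (ζ e₀) : Set Γ) := by
      rw [← MonoidHom.coe_coe, ← Subgroup.coe_map, MonoidHom.map_zpowers]
    rw [h2] at h1
    exact h1
  · refine Subgroup.topologicalClosure_minimal _ ?_ ?_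
    · exact (Subgroup.zpowers_le (G := Γ)).mpr ⟨e₀, rfl⟩
    · change IsClosed (Set.range ζ)
      exact (isCompact_range ζ.continuous).isClosed

/-- The range of a continuous homomorphism from a compact group is compact.
[cite: MochizukiSemiAnbd2006, Rmk 3.1.1 p.33] -/
theorem ContinuousMonoidHom.isCompact_range {E : Type*} [Group E] [TopologicalSpace E] [CompactSpace E]
    {Γ : Type*} [Group Γ] [TopologicalSpace Γ] (ζ : E →ₜ* Γ) :
    IsCompact ((ζ.toMonoidHom.range : Subgroup Γ) : Set Γ) := by
  rw [MonoidHom.coe_range]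
  exact _root_.isCompact_range ζ.continuous

namespace ProfiniteSemiGraph

namespace GaloisLevelData

variable {𝒢 : ProfiniteSemiGraph.{u}} (D : GaloisLevelData 𝒢) (h𝒢 : 𝒢.IsCountable)

/-! ### Two continuous homomorphisms into `Gal_n` agreeing at a topological generator -/

/-- Two continuous homomorphisms from `E = closure⟨e₀⟩` into the discrete `Gal(𝒢_{∞,n}/𝒢)` that agree at
`e₀` agree everywhere. [cite: MochizukiSemiAnbd2006, Prop 3.6(i) p.38] -/
theorem hom_eq_of_apply_eq_of_dense {E : Type*} [Group E] [TopologicalSpace E] [IsTopologicalGroup E]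
    (e₀ : E) (hgen : (Subgroup.zpowers e₀).topologicalClosure = ⊤) (n : ℕ)
    (f g : E →* D.Gal h𝒢 n) (hf : Continuous f) (hg : Continuous g) (he₀ : f e₀ = g e₀) (t : E) :
    f t = g t := by
  have heqOn : Set.EqOn f g (Subgroup.zpowers e₀ : Set E) := by
    intro x hx
    obtain ⟨m, rfl⟩ := Subgroup.mem_zpowers_iff.mp hx
    rw [map_zpow, map_zpow, he₀]
  have hcl : Set.EqOn f g (closure (Subgroup.zpowers e₀ : Set E)) := heqOn.closure hf hg
  have ht : t ∈ closure (Subgroup.zpowers e₀ : Set E) := by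
    rw [← Subgroup.topologicalClosure_coe, hgen]
    exact Subgroup.mem_top t
  exact hcl ht

/-! ### The limit homomorphism -/

/-- **Limits of level-wise eventually constant sequences of continuous homomorphisms.**  Let
`ζ_k : E →ₜ* π₁^temp(𝒢)` (`k ∈ ℕ`) be continuous homomorphisms from a topologically cyclic group
`E = closure⟨e₀⟩` such that, for every level `n`, `ρ_n(ζ_{k+1} e₀) = ρ_n(ζ_k e₀)` for `k ≫ 0`.  Then there is
a continuous homomorphism `ζ : E →ₜ* π₁^temp(𝒢)` with `ρ_n(ζ t) = ρ_n(ζ_k t)` for all `t` and all `k ≥ N(n)`.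
[cite: MochizukiSemiAnbd2006, Prop 3.6(i) p.38] -/
theorem exists_limitHom {E : Type*} [Group E] [TopologicalSpace E] [IsTopologicalGroup E]
    (ζs : ℕ → (E →ₜ* D.temperedPi h𝒢)) (e₀ : E)
    (hgen : (Subgroup.zpowers e₀).topologicalClosure = ⊤)
    (hz : ∀ n, ∃ N, ∀ k, N ≤ k → D.proj h𝒢 n (ζs (k + 1) e₀) = D.proj h𝒢 n (ζs k e₀)) :
    ∃ ζ : E →ₜ* D.temperedPi h𝒢,
      ∀ n, ∃ N, ∀ k, N ≤ k → ∀ t, D.proj h𝒢 n (ζ t) = D.proj h𝒢 n (ζs k t) := by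
  -- Step 1: the level-`n` components are eventually constant, uniformly in `t`
  have hunif : ∀ n, ∃ N, ∀ k, N ≤ k → ∀ t, D.proj h𝒢 n (ζs k t) = D.proj h𝒢 n (ζs N t) := by
    intro n
    obtain ⟨N, hN⟩ := hz n
    refine ⟨N, fun k hk => ?_⟩
    have he₀ : D.proj h𝒢 n (ζs k e₀) = D.proj h𝒢 n (ζs N e₀) := by
      induction k, hk using Nat.le_induction with
      | base => rfl
      | succ k hk ih => rw [hN k hk, ih]
    exact D.hom_eq_of_apply_eq_of_dense h𝒢 e₀ hgen n ((D.proj h𝒢 n).comp (ζs k).toMonoidHom)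
      ((D.proj h𝒢 n).comp (ζs N).toMonoidHom) ((D.continuous_proj h𝒢 n).comp (ζs k).continuous)
      ((D.continuous_proj h𝒢 n).comp (ζs N).continuous) he₀
  choose N hN using hunif
  -- Step 2: a monotone majorant of `N`
  let M : ℕ → ℕ := fun n => (Finset.range (n + 1)).sup N
  have hNM : ∀ n, N n ≤ M n := fun n => Finset.le_sup (f := N) (Finset.self_mem_range_succ n)
  have hMmono : Monotone M := fun i j hij => Finset.sup_mono (Finset.range_mono (Nat.succ_le_succ hij))
  have hkey : ∀ n k, N n ≤ k → ∀ t, D.proj h𝒢 n (ζs k t) = D.proj h𝒢 n (ζs (M n) t) :=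
    fun n k hk t => (hN n k hk t).trans (hN n (M n) (hNM n) t).symm
  -- Step 3: the compatible family `(ρ_n (ζ_{M n} t))_n` and the limit
  have hcompat : ∀ t n, D.step h𝒢 n (D.proj h𝒢 (n + 1) (ζs (M (n + 1)) t)) =
      D.proj h𝒢 n (ζs (M n) t) := by
    intro t n
    rw [D.step_proj h𝒢]
    exact hkey n (M (n + 1)) ((hNM n).trans (hMmono (Nat.le_succ n))) t
  let ζf : E → D.temperedPi h𝒢 := fun t =>
    D.mkPi h𝒢 (fun n => D.proj h𝒢 n (ζs (M n) t)) (hcompat t)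
  have hζf : ∀ t n, D.proj h𝒢 n (ζf t) = D.proj h𝒢 n (ζs (M n) t) := fun t n => D.proj_mkPi h𝒢 _ _ n
  let ζm : E →* D.temperedPi h𝒢 :=
    { toFun := ζf
      map_one' := D.pi_ext h𝒢 fun n => by simp only [hζf, map_one]
      map_mul' := fun s t => D.pi_ext h𝒢 fun n => by
        rw [hζf, map_mul, map_mul, map_mul, hζf, hζf] }
  have hcont : Continuous ζm := by
    refine continuous_induced_rng.2 (continuous_pi fun i => ?_)
    obtain ⟨n⟩ := i
    change Continuous fun t => D.proj h𝒢 n (ζs (M n) t)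
    exact (D.continuous_proj h𝒢 n).comp (ζs (M n)).continuous
  refine ⟨⟨ζm, hcont⟩, fun n => ⟨N n, fun k hk t => ?_⟩⟩
  change D.proj h𝒢 n (ζf t) = _
  rw [hζf, hkey n k hk t]

/-- **The limit homomorphism with its range**: under the hypotheses of `exists_limitHom`, with `E` compact,
there is `ζ : E →ₜ* π₁^temp(𝒢)` with (i) `ρ_n ∘ ζ = ρ_n ∘ ζ_k` for `k ≥ N(n)`, (ii) range `ζ = closure⟨ζ e₀⟩`,
a COMPACT subgroup. [cite: MochizukiSemiAnbd2006, Thm 3.7(iii) p.41] -/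
theorem exists_limitHom_range {E : Type*} [Group E] [TopologicalSpace E] [IsTopologicalGroup E]
    [CompactSpace E] (ζs : ℕ → (E →ₜ* D.temperedPi h𝒢)) (e₀ : E)
    (hgen : (Subgroup.zpowers e₀).topologicalClosure = ⊤)
    (hz : ∀ n, ∃ N, ∀ k, N ≤ k → D.proj h𝒢 n (ζs (k + 1) e₀) = D.proj h𝒢 n (ζs k e₀)) :
    ∃ ζ : E →ₜ* D.temperedPi h𝒢,
      (∀ n, ∃ N, ∀ k, N ≤ k → ∀ t, D.proj h𝒢 n (ζ t) = D.proj h𝒢 n (ζs k t)) ∧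
      ζ.toMonoidHom.range = (Subgroup.zpowers (ζ e₀)).topologicalClosure ∧
      IsCompact ((ζ.toMonoidHom.range : Subgroup (D.temperedPi h𝒢)) : Set (D.temperedPi h𝒢)) := by
  obtain ⟨ζ, hζ⟩ := D.exists_limitHom h𝒢 ζs e₀ hgen hz
  haveI : T2Space (D.temperedPi h𝒢) := D.t2Space_temperedPi h𝒢
  exact ⟨ζ, hζ, ContinuousMonoidHom.range_eq_topologicalClosure_zpowers ζ e₀ hgen,
    ContinuousMonoidHom.isCompact_range ζ⟩

end GaloisLevelData

end ProfiniteSemiGraph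

end Literature.AnabelianGeometry.SemiGraphs
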